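import Summits.NavierStokesRegularity.NavierStokesRegularity.Theorems.AdaptedKernelExists.Negative.UniformDriftKernel
import Literature.Analysis.FluidPDE.DriftHeatLocalClass
import Literature.Analysis.FluidPDE.SpaceTimeCalculus
import Literature.Analysis.FluidPDE.WholeSpaceIBP

/-!
# `AdaptedKernelExists` (stmt-NavierStokesRegularity-2956): the co-moving BRIDGE — an adapted kernel of a uniform drift is a zero-drift heat solution

Support lemmas for the crux `AdaptedFrequency.AdaptedKernelExists`, extracted from the crux work
file `Cruxes/AdaptedKernelExists/Disproof.lean` (cdisprove seat, cycle 2, §6, first half). No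
conclusion asserts a route item.

THE CO-MOVING FRAME of a uniform drift `a(t) e` (`UniformDriftKernel`): if `D' = -a` on `(t₀, T)`
then `v(σ, y) := G(T - σ/ν, y - D(T - σ/ν) e)` (`comoving`) solves the FORWARD HEAT EQUATION with
ZERO drift whenever `G` is an adapted kernel of `a(t) e` on a time set `S ⊇ (t₀, T)`:
`hasDerivAt_comoving` (the transport terms cancel EXACTLY — `∂ₜG + a e·∇G = -νΔG` and the moving
frame contributes `-a e·∇G`) and `isDriftHeatSolutionOn_comoving`, the BRIDGE from
`IsAdaptedBackwardKernel` to the tree's local time-integrated class `IsDriftHeatSolutionOn`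
(`DriftHeatLocalClass`) with drift bound `A = 0`: `C²` slices, joint continuity of the slice
derivative and slice Laplacian from the joint `C²` clause on the OPEN slab
(`continuousOn_fderiv_slice'`, `continuousOn_laplacian_slice` — stated for any jointly `C²`
kernel, reusable by the line's stubs 2–3 whose BRIDGE is the general-drift version in reversed
time), and the integrated identity by the fundamental theorem of calculus on time lines. Used by
`ComovingDisplacement` (comparability forces parabolic displacement; the rate is load-bearing
unconditionally). [folklore]
-/

noncomputable section

namespace Summit.NavierStokesRegularity.NavierStokesRegularity.Theorems.AdaptedKernelExistsNegative.Comoving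

open Set Filter Topology MeasureTheory Function
open scoped Laplacian InnerProductSpace RealInnerProductSpace ContDiff
open Literature.Analysis.FluidPDE Literature.Analysis

local notation "ℝ³" => EuclideanSpace ℝ (Fin 3)

open UniformDrift

section Comoving

variable {ν t₀ T : ℝ} {x₀ e : ℝ³} {a D : ℝ → ℝ} {S : Set ℝ} {G : ℝ → ℝ³ → ℝ}

/-- Translation commutes with the derivative: `D(f(· - c))(y) = Df(y - c)`. [folklore] -/
theorem fderiv_comp_sub_const_eq (f : ℝ³ → ℝ) (c y : ℝ³) :
    fderiv ℝ (fun w => f (w - c)) y = fderiv ℝ f (y - c) := by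
  simpa [sub_eq_add_neg] using fderiv_comp_add_right (f := f) (x := y) (-c)

/-- Translation commutes with the Laplacian: `Δ(f(· - c))(y) = (Δ f)(y - c)`. [folklore] -/
theorem laplacian_comp_sub_const_eq (f : ℝ³ → ℝ) (c y : ℝ³) :
    (Δ (fun w => f (w - c))) y = (Δ f) (y - c) := by
  rw [InnerProductSpace.laplacian_eq_iteratedFDeriv_stdOrthonormalBasis,
    InnerProductSpace.laplacian_eq_iteratedFDeriv_stdOrthonormalBasis]
  simp only [sub_eq_add_neg, iteratedFDeriv_comp_add_right]

/-- **The co-moving, time-reversed transform** of a kernel `G` along the displacement `D` of a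
uniform drift: `v(σ, y) = G(T - σ/ν, y - D(T - σ/ν) e)` (`σ = ν(T - t)` is the forward age). -/
def comoving (ν T : ℝ) (e : ℝ³) (D : ℝ → ℝ) (G : ℝ → ℝ³ → ℝ) (σ : ℝ) (y : ℝ³) : ℝ :=
  G (T - σ / ν) (y - D (T - σ / ν) • e)

/-- Unfolding `comoving`. [folklore] -/
@[simp] theorem comoving_apply (ν T : ℝ) (e : ℝ³) (D : ℝ → ℝ) (G : ℝ → ℝ³ → ℝ) (σ : ℝ) (y : ℝ³) :
    comoving ν T e D G σ y = G (T - σ / ν) (y - D (T - σ / ν) • e) := rfl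

/-- The age `σ ∈ (0, ν(T - t₀))` corresponds to the time `T - σ/ν ∈ (t₀, T)`. [folklore] -/
theorem time_mem_Ioo_of_age (hν : 0 < ν) {σ : ℝ} (hσ : σ ∈ Ioo 0 (ν * (T - t₀))) :
    T - σ / ν ∈ Ioo t₀ T := by
  have h1 : 0 < σ / ν := div_pos hσ.1 hν
  have h2 : σ / ν < T - t₀ := by rw [div_lt_iff₀ hν]; linarith [hσ.2]
  exact ⟨by linarith, by linarith⟩

/-- Slices of a jointly `C²` kernel are `C²`. [folklore] -/
theorem contDiff_slice_of_contDiffOn {Φ : ℝ → ℝ³ → ℝ} {O : Set ℝ}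
    (hΦ : ContDiffOn ℝ 2 (uncurry Φ) (O ×ˢ univ)) {t : ℝ} (ht : t ∈ O) : ContDiff ℝ 2 (Φ t) :=
  hΦ.comp_contDiff (f := fun y : ℝ³ => (t, y)) (contDiff_const.prodMk contDiff_id)
    fun y => ⟨ht, mem_univ y⟩

/-- On an OPEN time set, a jointly `C²` kernel is differentiable at every point, with the slice
and time-line derivatives read off the joint derivative. [folklore] -/
theorem hasFDerivAt_uncurry_of_contDiffOn {Φ : ℝ → ℝ³ → ℝ} {O : Set ℝ} (hO : IsOpen O)
    (hΦ : ContDiffOn ℝ 2 (uncurry Φ) (O ×ˢ univ)) {t : ℝ} (ht : t ∈ O) (x : ℝ³) :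
    HasFDerivAt (uncurry Φ) (fderiv ℝ (uncurry Φ) (t, x)) (t, x) :=
  ((hΦ.differentiableOn (by simp)).differentiableAt
    ((hO.prod isOpen_univ).mem_nhds ⟨ht, mem_univ x⟩)).hasFDerivAt

/-- The partial derivative field `Φᵢ(t, x) = D(uncurry Φ)(t, x)(0, b)` of a jointly `C²` kernel is
jointly `C¹` on the open slab. [folklore] -/
theorem contDiffOn_partial_of_contDiffOn {Φ : ℝ → ℝ³ → ℝ} {O : Set ℝ} (hO : IsOpen O)
    (hΦ : ContDiffOn ℝ 2 (uncurry Φ) (O ×ˢ univ)) (b : ℝ³) :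
    ContDiffOn ℝ 1 (fun q : ℝ × ℝ³ => fderiv ℝ (uncurry Φ) q ((0 : ℝ), b)) (O ×ˢ univ) :=
  (hΦ.fderiv_of_isOpen (hO.prod isOpen_univ) le_rfl).clm_apply contDiffOn_const

/-- Slice derivative along `b` = the partial derivative field: `D(Φ t)(x) b = D(uncurry Φ)(t,x)(0,b)`
on the open slab. [folklore] -/
theorem fderiv_slice_apply_eq {Φ : ℝ → ℝ³ → ℝ} {O : Set ℝ} (hO : IsOpen O)
    (hΦ : ContDiffOn ℝ 2 (uncurry Φ) (O ×ˢ univ)) {t : ℝ} (ht : t ∈ O) (x b : ℝ³) :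
    fderiv ℝ (Φ t) x b = fderiv ℝ (uncurry Φ) (t, x) ((0 : ℝ), b) := by
  rw [(hasFDerivAt_slice (hasFDerivAt_uncurry_of_contDiffOn hO hΦ ht x)).fderiv]
  simp

/-- **The slice Laplacian of a jointly `C²` kernel is jointly continuous** on the open slab:
`Δ(Φ t)(x) = Σᵢ D(Φᵢ)(t, x)(0, bᵢ)` with `Φᵢ` the `C¹` partial derivative fields. [folklore] -/
theorem continuousOn_laplacian_slice {Φ : ℝ → ℝ³ → ℝ} {O : Set ℝ} (hO : IsOpen O)
    (hΦ : ContDiffOn ℝ 2 (uncurry Φ) (O ×ˢ univ)) :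
    ContinuousOn (fun q : ℝ × ℝ³ => (Δ (Φ q.1)) q.2) (O ×ˢ univ) := by
  set bs : OrthonormalBasis (Fin 3) ℝ ℝ³ := EuclideanSpace.basisFun (Fin 3) ℝ with hbs
  -- the partial derivative fields
  set P : Fin 3 → ℝ × ℝ³ → ℝ := fun i q => fderiv ℝ (uncurry Φ) q ((0 : ℝ), bs i) with hP
  have hP1 : ∀ i, ContDiffOn ℝ 1 (P i) (O ×ˢ univ) := fun i =>
    contDiffOn_partial_of_contDiffOn hO hΦ (bs i)
  have hF : ContinuousOn (fun q : ℝ × ℝ³ => ∑ i, fderiv ℝ (P i) q ((0 : ℝ), bs i)) (O ×ˢ univ) := by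
    refine continuousOn_finsetSum _ fun i _ => ?_
    exact ((hP1 i).continuousOn_fderiv_of_isOpen (hO.prod isOpen_univ) le_rfl).clm_apply
      continuousOn_const
  refine hF.congr ?_
  rintro ⟨t, x⟩ ⟨ht, -⟩
  dsimp only
  -- `Δ(Φ t)(x) = Σᵢ ∂ᵢ∂ᵢ`
  rw [laplacian_eq_sum_fderiv_fderiv bs (contDiff_slice_of_contDiffOn hΦ ht) x]
  refine Finset.sum_congr rfl fun i _ => ?_
  -- the inner slice `y ↦ D(Φ t)(y)(bᵢ)` is the slice of `P i`
  have hfun : (fun y => fderiv ℝ (Φ t) y (bs i)) = fun y => P i (t, y) :=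
    funext fun y => fderiv_slice_apply_eq hO hΦ ht y (bs i)
  rw [hfun]
  have hd : HasFDerivAt (P i) (fderiv ℝ (P i) (t, x)) (t, x) :=
    (((hP1 i).differentiableOn one_ne_zero).differentiableAt
      ((hO.prod isOpen_univ).mem_nhds ⟨ht, mem_univ x⟩)).hasFDerivAt
  rw [(hasFDerivAt_slice (w := fun t y => P i (t, y)) hd).fderiv]
  simp

/-- The slice derivative of a jointly `C²` kernel is jointly continuous on the open slab. [folklore] -/
theorem continuousOn_fderiv_slice' {Φ : ℝ → ℝ³ → ℝ} {O : Set ℝ} (hO : IsOpen O)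
    (hΦ : ContDiffOn ℝ 2 (uncurry Φ) (O ×ˢ univ)) :
    ContinuousOn (fun q : ℝ × ℝ³ => fderiv ℝ (Φ q.1) q.2) (O ×ˢ univ) := by
  have hF : ContinuousOn (fun q : ℝ × ℝ³ => (fderiv ℝ (uncurry Φ) q).comp
      (ContinuousLinearMap.inr ℝ ℝ ℝ³)) (O ×ˢ univ) :=
    (hΦ.continuousOn_fderiv_of_isOpen (hO.prod isOpen_univ) (by simp)).clm_comp
      continuousOn_const
  refine hF.congr ?_
  rintro ⟨t, x⟩ ⟨ht, -⟩
  exact (hasFDerivAt_slice (hasFDerivAt_uncurry_of_contDiffOn hO hΦ ht x)).fderiv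

/-- The co-moving space-time change of variables `(σ, y) ↦ (T - σ/ν, y - D(T - σ/ν) e)` is
continuous on the age slab and maps it into the open time slab. [folklore] -/
theorem continuousOn_comovingMap (hν : 0 < ν) (hD : ∀ t ∈ Ioo t₀ T, HasDerivAt D (-a t) t) :
    ContinuousOn (fun q : ℝ × ℝ³ => ((T - q.1 / ν, q.2 - D (T - q.1 / ν) • e) : ℝ × ℝ³))
      (Ioo 0 (ν * (T - t₀)) ×ˢ univ) ∧
    MapsTo (fun q : ℝ × ℝ³ => ((T - q.1 / ν, q.2 - D (T - q.1 / ν) • e) : ℝ × ℝ³))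
      (Ioo 0 (ν * (T - t₀)) ×ˢ univ) (Ioo t₀ T ×ˢ univ) := by
  have hDc : ContinuousOn D (Ioo t₀ T) := fun t ht => (hD t ht).continuousAt.continuousWithinAt
  have hτ : Continuous fun q : ℝ × ℝ³ => T - q.1 / ν := by fun_prop
  have hτmaps : MapsTo (fun q : ℝ × ℝ³ => T - q.1 / ν) (Ioo 0 (ν * (T - t₀)) ×ˢ univ) (Ioo t₀ T) :=
    fun q hq => time_mem_Ioo_of_age hν (mem_prod.1 hq).1
  have hDτ : ContinuousOn (fun q : ℝ × ℝ³ => D (T - q.1 / ν)) (Ioo 0 (ν * (T - t₀)) ×ˢ univ) :=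
    hDc.comp hτ.continuousOn hτmaps
  refine ⟨hτ.continuousOn.prodMk (continuousOn_snd.sub (hDτ.smul continuousOn_const)), ?_⟩
  intro q hq
  exact ⟨hτmaps hq, mem_univ _⟩

/-- **Time-line derivative in the co-moving frame.** If `G` is an adapted kernel of the uniform
drift `a(t) e` on a time set `S ⊇ (t₀, T)` and `D' = -a` on `(t₀, T)`, then for every age
`σ ∈ (0, ν(T - t₀))` the time line of `v = comoving ν T e D G` has derivative `Δ(v σ)(y)` at `σ`:
the transport terms cancel EXACTLY (`∂ₜG + a e·∇G = -νΔG` and the moving frame contributes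
`-a e·∇G`). [folklore] -/
theorem hasDerivAt_comoving (hν : 0 < ν) (hS : Ioo t₀ T ⊆ S)
    (hK : IsAdaptedBackwardKernel ν (uniformVel a e) S T x₀ G)
    (hD : ∀ t ∈ Ioo t₀ T, HasDerivAt D (-a t) t) {σ : ℝ} (hσ : σ ∈ Ioo 0 (ν * (T - t₀)))
    (y : ℝ³) :
    HasDerivAt (fun r => comoving ν T e D G r y) ((Δ (comoving ν T e D G σ)) y) σ := by
  have hO : IsOpen (Ioo t₀ T) := isOpen_Ioo
  have hΦ : ContDiffOn ℝ 2 (uncurry G) (Ioo t₀ T ×ˢ univ) :=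
    hK.contDiffOn.mono (prod_mono hS Subset.rfl)
  have ht : T - σ / ν ∈ Ioo t₀ T := time_mem_Ioo_of_age hν hσ
  set t : ℝ := T - σ / ν with htdef
  set z : ℝ³ := y - D t • e with hz
  set L : ℝ × ℝ³ →L[ℝ] ℝ := fderiv ℝ (uncurry G) (t, z) with hL
  have hGd : HasFDerivAt (uncurry G) L (t, z) := hasFDerivAt_uncurry_of_contDiffOn hO hΦ ht z
  -- the curve `r ↦ (T - r/ν, y - D(T - r/ν) e)`
  have h1 : HasDerivAt (fun r : ℝ => T - r / ν) (-(1 / ν)) σ := by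
    simpa using ((hasDerivAt_id σ).div_const ν).const_sub T
  have h2 : HasDerivAt (fun r : ℝ => D (T - r / ν)) (a t / ν) σ :=
    ((hD t ht).comp σ h1).congr_deriv (by ring)
  have h3 : HasDerivAt (fun r : ℝ => y - D (T - r / ν) • e) (-((a t / ν) • e)) σ := by
    simpa using (h2.smul_const e).const_sub y
  have hγ := h1.prodMk h3
  have hcomp := hGd.comp_hasDerivAt σ hγ
  have hfun : (uncurry G ∘ fun r : ℝ => ((T - r / ν, y - D (T - r / ν) • e) : ℝ × ℝ³)) =
      fun r => comoving ν T e D G r y := by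
    funext r
    simp [comoving]
  rw [hfun] at hcomp
  refine hcomp.congr_deriv ?_
  -- the adjoint equation at `(t, z)` in terms of `L`
  have hadj := hK.adjoint_eq t (hS ht) z
  have htd : timeDerivWithin S G t z = L ((1 : ℝ), (0 : ℝ³)) := by
    rw [timeDerivWithin_eq_deriv_of_mem_nhds (mem_of_superset (Ioo_mem_nhds ht.1 ht.2) hS)]
    exact (hasDerivAt_timeLine hGd).deriv
  have hsd : fderiv ℝ (G t) z (uniformVel a e t z) = a t * L ((0 : ℝ), e) := by
    rw [(hasFDerivAt_slice hGd).fderiv, uniformVel_apply, ContinuousLinearMap.comp_apply,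
      ContinuousLinearMap.inr_apply, show ((0 : ℝ), a t • e) = a t • ((0 : ℝ), e) by simp,
      map_smul, smul_eq_mul]
  rw [htd, hsd] at hadj
  -- `Δ (v σ) y = Δ (G t) z`
  have hlap : (Δ (comoving ν T e D G σ)) y = (Δ (G t)) z := by
    have : comoving ν T e D G σ = fun w => G t (w - D t • e) := by
      funext w; simp [comoving, htdef]
    rw [this, laplacian_comp_sub_const_eq]
  rw [hlap]
  have hsplit : ((-(1 / ν) : ℝ), -((a t / ν) • e)) =
      (-(1 / ν)) • ((1 : ℝ), (0 : ℝ³)) + (-(a t / ν)) • ((0 : ℝ), e) :=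
    Prod.ext (by simp) (by simp [neg_smul])
  rw [hsplit, map_add, map_smul, map_smul, smul_eq_mul, smul_eq_mul]
  have hν0 : ν ≠ 0 := hν.ne'
  have key : L ((1 : ℝ), (0 : ℝ³)) + a t * L ((0 : ℝ), e) = -(ν * (Δ (G t)) z) := by linarith
  have hre : -(1 / ν) * L ((1 : ℝ), (0 : ℝ³)) + -(a t / ν) * L ((0 : ℝ), e) =
      -(1 / ν) * (L ((1 : ℝ), (0 : ℝ³)) + a t * L ((0 : ℝ), e)) := by ring
  rw [hre, key]
  field_simp

/-- **BRIDGE (co-moving frame, zero drift).** For an adapted kernel `G` of the uniform drift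
`a(t) e` on a time set `S ⊇ (t₀, T)` and a displacement `D` with `D' = -a` on `(t₀, T)`, the
transform `v(σ, y) = G(T - σ/ν, y - D(T - σ/ν) e)` belongs to the tree's local time-integrated
drift–heat class with ZERO drift on the ages `(0, ν(T - t₀))` and all of space: `C²` slices,
jointly continuous `Dv`, `Δv`, and `v(t) - v(s) = ∫ₛᵗ Δv` (fundamental theorem of calculus on the
time lines, `hasDerivAt_comoving`). This is the special case, needed here, of the BRIDGE the
picked line's stubs 2–3 require (there: a general drift, reversed time `σ = ν(t′ - τ)`). -/
theorem isDriftHeatSolutionOn_comoving (hν : 0 < ν) (hS : Ioo t₀ T ⊆ S)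
    (hK : IsAdaptedBackwardKernel ν (uniformVel a e) S T x₀ G)
    (hD : ∀ t ∈ Ioo t₀ T, HasDerivAt D (-a t) t) :
    IsDriftHeatSolutionOn (fun _ _ => (0 : ℝ³)) (comoving ν T e D G) 0
      (Ioo 0 (ν * (T - t₀))) univ := by
  have hO : IsOpen (Ioo t₀ T) := isOpen_Ioo
  have hΦ : ContDiffOn ℝ 2 (uncurry G) (Ioo t₀ T ×ˢ univ) :=
    hK.contDiffOn.mono (prod_mono hS Subset.rfl)
  obtain ⟨hΨc, hΨmaps⟩ := continuousOn_comovingMap (T := T) (e := e) hν hD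
  have hlapc : ContinuousOn (fun q : ℝ × ℝ³ => (Δ (comoving ν T e D G q.1)) q.2)
      (Ioo 0 (ν * (T - t₀)) ×ˢ univ) := by
    have h := (continuousOn_laplacian_slice hO hΦ).comp hΨc hΨmaps
    refine h.congr ?_
    rintro ⟨σ, y⟩ -
    have : comoving ν T e D G σ = fun w => G (T - σ / ν) (w - D (T - σ / ν) • e) := rfl
    simp only [Function.comp_apply]
    rw [this, laplacian_comp_sub_const_eq]
  refine
    { measurable_drift := measurable_const
      norm_drift_le := fun _ _ _ _ => by simp
      contDiffOn := fun σ hσ => ?_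
      continuousOn_fderiv := ?_
      continuousOn_laplacian := hlapc
      integral_eq := fun y _ s hs t ht hst => ?_ }
  · -- `C²` slices
    have ht := time_mem_Ioo_of_age hν hσ
    have h1 : ContDiff ℝ 2 (G (T - σ / ν)) := contDiff_slice_of_contDiffOn hΦ ht
    have : comoving ν T e D G σ = (G (T - σ / ν)) ∘ fun w => w - D (T - σ / ν) • e := rfl
    rw [this]
    exact (h1.comp (contDiff_id.sub contDiff_const)).contDiffOn
  · -- joint continuity of the slice derivative
    have h := (continuousOn_fderiv_slice' hO hΦ).comp hΨc hΨmaps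
    refine h.congr ?_
    rintro ⟨σ, y⟩ -
    have : comoving ν T e D G σ = fun w => G (T - σ / ν) (w - D (T - σ / ν) • e) := rfl
    simp only [Function.comp_apply]
    rw [this, fderiv_comp_sub_const_eq]
  · -- the time-integrated identity, by the fundamental theorem of calculus
    have hsub : uIcc s t ⊆ Ioo 0 (ν * (T - t₀)) := ordConnected_Ioo.uIcc_subset hs ht
    have hderiv : ∀ r ∈ uIcc s t, HasDerivAt (fun r' => comoving ν T e D G r' y)
        ((Δ (comoving ν T e D G r)) y) r := fun r hr =>
      hasDerivAt_comoving hν hS hK hD (hsub hr) y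
    have hcont : ContinuousOn (fun r => (Δ (comoving ν T e D G r)) y) (uIcc s t) :=
      continuousOn_time_slice (F := fun q : ℝ × ℝ³ => (Δ (comoving ν T e D G q.1)) q.2)
        hlapc (mem_univ y) hsub
    simp only [map_zero, sub_zero]
    exact (intervalIntegral.integral_eq_sub_of_hasDerivAt hderiv hcont.intervalIntegrable).symm

end Comoving

end Summit.NavierStokesRegularity.NavierStokesRegularity.Theorems.AdaptedKernelExistsNegative.Comoving

end
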